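import Literature.MathematicalPhysics.QuantumLattice.SU2HaarSmallBallUpper
import Mathlib.Tactic.NoncommRing

/-!
# LINE-20 stub U3 `LandauBallUniqueness`, part 2: the per-edge monotonicity inequality in `ℍ`

Pure quaternion algebra (Mathlib + the tree's `SU2HaarSmallBallUpper.abs_re_le_norm`) behind the uniqueness of the lattice Landau gauge in a small gauge ball (registered stub U3
`stub_landauBallUniqueness` of LINE-20 «landau-rung3», crux `AllWindowsColdBox.BoxWindowHighSU2213` ⟨stmt-QuantumFields-24336⟩, parent
⟨stmt-QuantumFields-24004⟩).  For unit quaternions `x, y` (the gauge transformation at the two ends of an edge), a link variable `V` and the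
transformed link `W = x V ȳ`, the edge term of the summed-by-parts lattice Landau identities is the real inner product of imaginary parts
`⟪Im (x − y), Im (W − V)⟫`.

* `inner_im_eq` — `⟪Im a, Im b⟫ = Σ_c a_c b_c`; `abs_inner_im_le` (Cauchy–Schwarz form used below, `‖Im b‖ ≤ ‖b‖`);
* `norm_sub_le_of_transform` — `‖x − y‖ ≤ ‖V − 1‖ + ‖x V ȳ − 1‖` (`x − y = x(1 − V) + (W − 1)y`, `‖x‖ = ‖y‖ = 1`);
* `inner_im_sub_mul_star_eq` — the EXACT identity `⟪Im (x − y), Im (x ȳ)⟫ = y.re·|Im x|² + x.re·|Im y|² − (x.re + y.re)·⟪Im x, Im y⟫`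
  (the cross-product part of `Im (x ȳ)` is orthogonal to both), whence `≥ ½(x.re + y.re)·‖Im (x − y)‖²` for unit `x, y` with
  `0 ≤ x.re + y.re` (`inner_im_sub_mul_star_ge`; the defect is exactly `½ (y.re − x.re)² (x.re + y.re)`);
* **`edge_pairing_lower`** — `½(x.re + y.re)‖Im (x − y)‖² ≤ ⟪Im (x − y), Im (W − V)⟫ + ‖Im (x − y)‖·‖V − 1‖·(‖x − 1‖ + ‖y − 1‖)`,
  from `W − V = (x ȳ − 1) + (x − 1)(V − 1)ȳ + (V − 1)(ȳ − 1)` (`transform_sub_eq`, `norm_remainder_le`);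
* `norm_sub_one_sq_le`, `one_sub_norm_le_re` (via the tree's `abs_re_le_norm`), and the squared (AM–GM) form **`edge_pairing_lower_sq`** used by the
  lattice sum: `(5/8)‖Im (x − y)‖² − 4 r² (‖Im x‖² + ‖Im y‖²) ≤ ⟪Im (x − y), Im (W − V)⟫` when `x.re, y.re ≥ 7/8` and `‖V − 1‖ ≤ r`.

Everything proved; no definitions; standard axioms.  HONEST LABEL: helper toward ONE registered stub (U3) of a critic-stamped DRAFT line on the
R2ξ″ crux; no stub is proved by name here, no crux, rung or summit is proved; the Yang–Mills mass gap is NOT proved by this file.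
-/

set_option autoImplicit false

noncomputable section

open Quaternion

namespace Summit.QuantumFields.YangMills.Theorems.AllWindowsColdBoxBoxHighLine.LandauBall

/-! ## The inner product of imaginary parts -/

/-- `⟪Im a, Im b⟫ = Σ_{c ∈ {I,J,K}} a_c b_c`. -/
theorem inner_im_eq (a b : ℍ) : inner ℝ a.im b.im = a.imI * b.imI + a.imJ * b.imJ + a.imK * b.imK := by
  rw [Quaternion.inner_def, re_mul]
  simp

/-- `normSq a = a.re² + normSq (Im a)`. -/
theorem normSq_eq_re_sq_add_normSq_im (a : ℍ) : normSq a = a.re ^ 2 + normSq a.im := by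
  rw [normSq_def', normSq_def']
  simp only [re_im, imI_im, imJ_im, imK_im]
  change a.re ^ 2 + a.imI ^ 2 + a.imJ ^ 2 + a.imK ^ 2 = a.re ^ 2 + ((0:ℝ) ^ 2 + a.imI ^ 2 + a.imJ ^ 2 + a.imK ^ 2)
  ring

/-- Cauchy–Schwarz: `|⟪Im a, Im b⟫| ≤ ‖Im a‖·‖b‖`. -/
theorem abs_inner_im_le (a b : ℍ) : |inner ℝ a.im b.im| ≤ ‖a.im‖ * ‖b‖ := by
  have hb : ‖b.im‖ ≤ ‖b‖ := by
    have h := normSq_eq_re_sq_add_normSq_im b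
    rw [normSq_eq_norm_mul_self, normSq_eq_norm_mul_self] at h
    nlinarith [norm_nonneg b, norm_nonneg b.im, sq_nonneg b.re]
  exact (abs_real_inner_le_norm _ _).trans (mul_le_mul_of_nonneg_left hb (norm_nonneg _))

/-- `⟪Im a, Im a⟫ = ‖Im a‖²`. -/
theorem inner_im_self (a : ℍ) : inner ℝ a.im a.im = ‖a.im‖ ^ 2 :=
  real_inner_self_eq_norm_sq _

/-! ## Norm bookkeeping for unit quaternions -/

/-- **Edge difference**: `‖x − y‖ ≤ ‖V − 1‖ + ‖x V ȳ − 1‖` for unit `x, y` (`x − y = x(1 − V) + (xVȳ − 1)y`). -/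
theorem norm_sub_le_of_transform {x y : ℍ} (V : ℍ) (hx : ‖x‖ = 1) (hy : ‖y‖ = 1) :
    ‖x - y‖ ≤ ‖V - 1‖ + ‖x * V * star y - 1‖ := by
  have hyy : star y * y = 1 := by
    rw [Quaternion.star_mul_self, normSq_eq_norm_mul_self, hy, mul_one, Quaternion.coe_one]
  have key : x - y = x * (1 - V) + (x * V * star y - 1) * y := by
    rw [mul_sub, mul_one, sub_mul, one_mul, mul_assoc (x * V) (star y) y, hyy, mul_one]
    abel
  calc ‖x - y‖ = ‖x * (1 - V) + (x * V * star y - 1) * y‖ := by rw [← key]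
    _ ≤ ‖x * (1 - V)‖ + ‖(x * V * star y - 1) * y‖ := norm_add_le _ _
    _ = ‖V - 1‖ + ‖x * V * star y - 1‖ := by rw [norm_mul, norm_mul, hx, hy, one_mul, mul_one, norm_sub_rev]

/-- The components of a unit quaternion: `re² + ‖Im x‖² = 1`. -/
theorem re_sq_add_norm_im_sq {x : ℍ} (hx : ‖x‖ = 1) : x.re ^ 2 + ‖x.im‖ ^ 2 = 1 := by
  have h : normSq x = 1 := by rw [normSq_eq_norm_mul_self, hx, mul_one]
  rw [normSq_eq_re_sq_add_normSq_im, normSq_eq_norm_mul_self] at h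
  nlinarith [h]

/-- `1 − ‖x − 1‖ ≤ x.re`. -/
theorem one_sub_norm_le_re (x : ℍ) : 1 - ‖x - 1‖ ≤ x.re := by
  have h := Literature.MathematicalPhysics.QuantumLattice.abs_re_le_norm (x - 1)
  rw [re_sub, re_one] at h
  linarith [(abs_le.1 h).1]

/-- `‖x − 1‖² ≤ 2‖Im x‖²` for a unit quaternion in the hemisphere `0 ≤ x.re` (`2(1 − re) ≤ 2(1 − re²)`). -/
theorem norm_sub_one_sq_le {x : ℍ} (hx : ‖x‖ = 1) (hre : 0 ≤ x.re) : ‖x - 1‖ ^ 2 ≤ 2 * ‖x.im‖ ^ 2 := by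
  have hsq : ‖x - 1‖ ^ 2 = 2 - 2 * x.re := by
    rw [@norm_sub_sq_real ℍ, hx, norm_one, Quaternion.inner_def, star_one, mul_one]
    ring
  rw [hsq]
  have h := re_sq_add_norm_im_sq hx
  have h0 : 0 ≤ ‖x.im‖ ^ 2 := sq_nonneg _
  have h1 : x.re ≤ 1 := by nlinarith [h, sq_nonneg x.re, h0]
  nlinarith [h, mul_nonneg hre (sub_nonneg.2 h1)]

/-! ## The exact edge identity and the per-edge lower bound -/

/-- **Exact identity**: `⟪Im (x − y), Im (x ȳ)⟫ = y.re·‖Im x‖² + x.re·‖Im y‖² − (x.re + y.re)·⟪Im x, Im y⟫`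
(the `Im x × Im y` part of `Im (x ȳ)` pairs to zero with both `Im x` and `Im y`). -/
theorem inner_im_sub_mul_star_eq (x y : ℍ) :
    inner ℝ (x - y).im (x * star y).im = y.re * ‖x.im‖ ^ 2 + x.re * ‖y.im‖ ^ 2 - (x.re + y.re) * inner ℝ x.im y.im := by
  rw [← inner_im_self, ← inner_im_self, inner_im_eq, inner_im_eq, inner_im_eq, inner_im_eq]
  simp only [imI_sub, imJ_sub, imK_sub, imI_mul, imJ_mul, imK_mul, re_star, imI_star, imJ_star, imK_star]
  ring

/-- **Monotonicity of the principal part**: for unit `x, y` with `0 ≤ x.re + y.re`,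
`½(x.re + y.re)·‖Im (x − y)‖² ≤ ⟪Im (x − y), Im (x ȳ)⟫` (defect `½(y.re − x.re)²(x.re + y.re) ≥ 0`). -/
theorem inner_im_sub_mul_star_ge {x y : ℍ} (hx : ‖x‖ = 1) (hy : ‖y‖ = 1) (hre : 0 ≤ x.re + y.re) :
    (x.re + y.re) / 2 * ‖(x - y).im‖ ^ 2 ≤ inner ℝ (x - y).im (x * star y).im := by
  rw [inner_im_sub_mul_star_eq]
  have hxx := re_sq_add_norm_im_sq hx
  have hyy := re_sq_add_norm_im_sq hy
  have hself : ‖(x - y).im‖ ^ 2 = ‖x.im‖ ^ 2 + ‖y.im‖ ^ 2 - 2 * inner ℝ x.im y.im := by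
    rw [← inner_im_self, ← inner_im_self, ← inner_im_self, inner_im_eq, inner_im_eq, inner_im_eq, inner_im_eq]
    simp only [imI_sub, imJ_sub, imK_sub]; ring
  rw [hself]
  have key : y.re * ‖x.im‖ ^ 2 + x.re * ‖y.im‖ ^ 2 - (x.re + y.re) * inner ℝ x.im y.im -
      (x.re + y.re) / 2 * (‖x.im‖ ^ 2 + ‖y.im‖ ^ 2 - 2 * inner ℝ x.im y.im) = 1 / 2 * ((y.re - x.re) ^ 2 * (x.re + y.re)) := by
    linear_combination (1 / 2) * (y.re - x.re) * (hxx - hyy)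
  nlinarith [key, mul_nonneg (sq_nonneg (y.re - x.re)) hre]

/-- The remainder `W − V − (x ȳ − 1) = (x − 1)(V − 1)ȳ + (V − 1)(ȳ − 1)` is second order. -/
theorem transform_sub_eq (x y V : ℍ) :
    x * V * star y - V = (x * star y - 1) + ((x - 1) * (V - 1) * star y + (V - 1) * (star y - 1)) := by
  noncomm_ring

/-- Norm of the remainder: `‖(x − 1)(V − 1)ȳ + (V − 1)(ȳ − 1)‖ ≤ ‖V − 1‖(‖x − 1‖ + ‖y − 1‖)` for unit `y`. -/
theorem norm_remainder_le (x V : ℍ) {y : ℍ} (hy : ‖y‖ = 1) :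
    ‖(x - 1) * (V - 1) * star y + (V - 1) * (star y - 1)‖ ≤ ‖V - 1‖ * (‖x - 1‖ + ‖y - 1‖) := by
  have h1 : ‖(x - 1) * (V - 1) * star y‖ = ‖x - 1‖ * ‖V - 1‖ := by
    rw [norm_mul, norm_mul, norm_star, hy, mul_one]
  have h2 : ‖(V - 1) * (star y - 1)‖ = ‖V - 1‖ * ‖y - 1‖ := by
    have hs : star y - 1 = star (y - 1) := by rw [star_sub, star_one]
    rw [norm_mul, hs, norm_star]
  calc ‖(x - 1) * (V - 1) * star y + (V - 1) * (star y - 1)‖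
      ≤ ‖(x - 1) * (V - 1) * star y‖ + ‖(V - 1) * (star y - 1)‖ := norm_add_le _ _
    _ = ‖V - 1‖ * (‖x - 1‖ + ‖y - 1‖) := by rw [h1, h2]; ring

/-- **Per-edge lower bound** (the heart of U3): for unit `x, y` with `0 ≤ x.re + y.re` and any `V`, with `W = x V ȳ`,
`½(x.re + y.re)‖Im (x − y)‖² ≤ ⟪Im (x − y), Im (W − V)⟫ + ‖Im (x − y)‖·‖V − 1‖·(‖x − 1‖ + ‖y − 1‖)`. -/
theorem edge_pairing_lower {x y : ℍ} (V : ℍ) (hx : ‖x‖ = 1) (hy : ‖y‖ = 1) (hre : 0 ≤ x.re + y.re) :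
    (x.re + y.re) / 2 * ‖(x - y).im‖ ^ 2 ≤
      inner ℝ (x - y).im (x * V * star y - V).im + ‖(x - y).im‖ * (‖V - 1‖ * (‖x - 1‖ + ‖y - 1‖)) := by
  rw [transform_sub_eq]
  set R := (x - 1) * (V - 1) * star y + (V - 1) * (star y - 1) with hR
  have hsplit : inner ℝ (x - y).im ((x * star y - 1) + R).im = inner ℝ (x - y).im (x * star y).im + inner ℝ (x - y).im R.im := by
    rw [inner_im_eq, inner_im_eq, inner_im_eq]
    simp only [imI_add, imJ_add, imK_add, imI_sub, imJ_sub, imK_sub, imI_one, imJ_one, imK_one]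
    ring
  rw [hsplit]
  have hmain := inner_im_sub_mul_star_ge hx hy hre
  have hrem := abs_inner_im_le (x - y) ((x - 1) * (V - 1) * star y + (V - 1) * (star y - 1))
  have hR := norm_remainder_le x V hy
  have hprod : ‖(x - y).im‖ * ‖(x - 1) * (V - 1) * star y + (V - 1) * (star y - 1)‖ ≤
      ‖(x - y).im‖ * (‖V - 1‖ * (‖x - 1‖ + ‖y - 1‖)) := mul_le_mul_of_nonneg_left hR (norm_nonneg _)
  linarith [(abs_le.1 hrem).1]

/-- **Squared form used in the lattice sum** (AM–GM on the remainder, hemisphere bounds `x.re, y.re ≥ 7/8`, `‖V − 1‖ ≤ r`):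
`(5/8)‖Im (x − y)‖² − 4 r² (‖Im x‖² + ‖Im y‖²) ≤ ⟪Im (x − y), Im (W − V)⟫`. -/
theorem edge_pairing_lower_sq {x y V : ℍ} {r : ℝ} (hx : ‖x‖ = 1) (hy : ‖y‖ = 1) (hxr : 7 / 8 ≤ x.re) (hyr : 7 / 8 ≤ y.re)
    (hV : ‖V - 1‖ ≤ r) :
    5 / 8 * ‖(x - y).im‖ ^ 2 - 4 * r ^ 2 * (‖x.im‖ ^ 2 + ‖y.im‖ ^ 2) ≤ inner ℝ (x - y).im (x * V * star y - V).im := by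
  have h := edge_pairing_lower V hx hy (by linarith)
  have hx1 := norm_sub_one_sq_le hx (by linarith)
  have hy1 := norm_sub_one_sq_le hy (by linarith)
  set d := ‖(x - y).im‖ with hd
  set a := ‖x - 1‖
  set b := ‖y - 1‖
  have hd0 : 0 ≤ d := norm_nonneg _
  have ha0 : 0 ≤ a := norm_nonneg _
  have hb0 : 0 ≤ b := norm_nonneg _
  have hV0 : 0 ≤ ‖V - 1‖ := norm_nonneg _
  -- d‖V−1‖(a+b) ≤ d r (a+b) ≤ ¼ d² + r²(a+b)² ≤ ¼ d² + 2r²(a²+b²) ≤ ¼ d² + 4r²(‖Im x‖²+‖Im y‖²)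
  have h1 : d * (‖V - 1‖ * (a + b)) ≤ d * (r * (a + b)) :=
    mul_le_mul_of_nonneg_left (mul_le_mul_of_nonneg_right hV (by positivity)) hd0
  have h2 : d * (r * (a + b)) ≤ 1 / 4 * d ^ 2 + r ^ 2 * (a + b) ^ 2 := by
    nlinarith [sq_nonneg (d / 2 - r * (a + b))]
  have h3 : (a + b) ^ 2 ≤ 2 * (a ^ 2 + b ^ 2) := by nlinarith [sq_nonneg (a - b)]
  have h4 : r ^ 2 * (a + b) ^ 2 ≤ r ^ 2 * (2 * (2 * ‖x.im‖ ^ 2 + 2 * ‖y.im‖ ^ 2)) :=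
    mul_le_mul_of_nonneg_left (h3.trans (by linarith)) (sq_nonneg r)
  have h78 : 7 / 8 * d ^ 2 ≤ (x.re + y.re) / 2 * d ^ 2 := mul_le_mul_of_nonneg_right (by linarith) (sq_nonneg d)
  linarith

end Summit.QuantumFields.YangMills.Theorems.AllWindowsColdBoxBoxHighLine.LandauBall

end
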